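import Summits.AtomisticToContinuum.HydrodynamicLimit.Theses.MourreKoopmanCharges
import HarnessLib

/-!
# `StressStrongMixing` · line `birth`: the shape of a Koopman autocorrelation (positive-definite, bounded, even)

Support file for the crux item stmt-AtomisticToContinuum-9584 (`StressStrongMixing`, route `MourreKoopmanCharges` of
`AtomisticToContinuum/HydrodynamicLimit`), line `birth`, stub C1 `stub_stressSpectralDensity`: the registered open
obligation asks for an integrable spectral density `ρ` with `⟪U_s ξ_Π, ξ_Π⟫_ℋ = ∫ cos(sλ) ρ(λ) dλ`.  Here we record, for
the Koopman group `U` of ANY fluctuation dynamics `D` (Spohn's `ℋ`, `Literature.MathematicalPhysics.KineticTheory.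
FluctuationDynamics.koopman`) and any vector `ψ`, the three structural facts behind that ansatz (Bochner's theorem turns a
CONTINUOUS function with them into the cosine transform of a finite positive even measure; absolute continuity of that
measure is the open content of C1):

* `inner_koopman_koopman_eq` — stationarity `⟪U_s ψ, U_t ψ⟫ = ⟪U_{s-t} ψ, ψ⟫`;
* `sum_mul_inner_koopman_nonneg` — POSITIVE-DEFINITENESS: `0 ≤ Σᵢ Σⱼ cᵢ cⱼ ⟪U_{sᵢ-sⱼ} ψ, ψ⟫` (it is `‖Σᵢ cᵢ U_{sᵢ} ψ‖²`);
* `abs_inner_koopman_self_le` — `|⟪U_s ψ, ψ⟫| ≤ ‖ψ‖² = ⟪U_0 ψ, ψ⟫`, and `inner_koopman_self_neg` — evenness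
  `⟪U_{-s} ψ, ψ⟫ = ⟪U_s ψ, ψ⟫` (orthogonality of `U_s` on the real space `ℋ`).

References: B. Doyon, *Hydrodynamic projections and the emergence of linearised Euler equations in one-dimensional
isolated systems*, CMP 391 (2022), §4.3 Thm 4.11 (the Koopman isometries of `ℋ₀`); W. Rudin, *Fourier Analysis on
Groups*, §1.4.3 (Bochner).
-/

noncomputable section

open MeasureTheory ProbabilityTheory Filter Topology
open scoped InnerProductSpace ENNReal

namespace Summit.AtomisticToContinuum.HydrodynamicLimit.Theorems.MourreKoopmanChargesStressStrongMixing

open Literature.MathematicalPhysics.KineticTheory Literature.Analysis.FluidPDE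

section Shape

variable {G Ω : Type*} [AddCommGroup G] [MeasurableSpace G] [MeasurableSpace Ω] {ν : Measure G}
  {T : ShiftAction G Ω} [MeasurableNeg G] [ν.IsNegInvariant] (D : FluctuationDynamics ν T)

/-- **Stationarity of two-time inner products**: `⟪U_s ψ, U_t ψ⟫ = ⟪U_{s-t} ψ, ψ⟫` (unitarity `U_t⁻¹ = U_{-t}` and the
group law). [folklore] -/
theorem inner_koopman_koopman_eq (s t : ℝ) (ψ : D.FluctuationSpace) :
    ⟪D.koopman s ψ, D.koopman t ψ⟫_ℝ = ⟪D.koopman (s - t) ψ, ψ⟫_ℝ := by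
  have h := D.inner_koopman_koopman (-t) (D.koopman s ψ) (D.koopman t ψ)
  rw [← D.koopman_add_apply, ← D.koopman_add_apply, neg_add_cancel, D.koopman_zero_apply,
    neg_add_eq_sub] at h
  exact h.symm

/-- **Positive-definiteness of the autocorrelation**: for times `s i` and real coefficients `c i`,
`0 ≤ Σᵢ Σⱼ cᵢ cⱼ ⟪U_{sᵢ - sⱼ} ψ, ψ⟫` — the double sum is `‖Σᵢ cᵢ U_{sᵢ} ψ‖²`. [folklore] -/
theorem sum_mul_inner_koopman_nonneg {ι : Type*} (S : Finset ι) (s : ι → ℝ) (c : ι → ℝ)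
    (ψ : D.FluctuationSpace) :
    0 ≤ ∑ i ∈ S, ∑ j ∈ S, c i * c j * ⟪D.koopman (s i - s j) ψ, ψ⟫_ℝ := by
  have h : ∑ i ∈ S, ∑ j ∈ S, c i * c j * ⟪D.koopman (s i - s j) ψ, ψ⟫_ℝ =
      ⟪∑ i ∈ S, c i • D.koopman (s i) ψ, ∑ j ∈ S, c j • D.koopman (s j) ψ⟫_ℝ := by
    rw [sum_inner]
    refine Finset.sum_congr rfl fun i _ => ?_
    rw [inner_sum]
    refine Finset.sum_congr rfl fun j _ => ?_
    rw [real_inner_smul_left, real_inner_smul_right, inner_koopman_koopman_eq]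
    ring
  rw [h]
  exact real_inner_self_nonneg

/-- **The autocorrelation at time zero is `‖ψ‖²`.** [folklore] -/
theorem inner_koopman_zero_self (ψ : D.FluctuationSpace) : ⟪D.koopman 0 ψ, ψ⟫_ℝ = ‖ψ‖ ^ 2 := by
  rw [D.koopman_zero_apply, real_inner_self_eq_norm_sq]

/-- **Boundedness**: `|⟪U_s ψ, ψ⟫| ≤ ‖ψ‖²` (Cauchy–Schwarz and `‖U_s ψ‖ = ‖ψ‖`). [folklore] -/
theorem abs_inner_koopman_self_le (s : ℝ) (ψ : D.FluctuationSpace) : |⟪D.koopman s ψ, ψ⟫_ℝ| ≤ ‖ψ‖ ^ 2 := by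
  have h := abs_real_inner_le_norm (D.koopman s ψ) ψ
  rw [LinearIsometryEquiv.norm_map] at h
  rw [sq]
  exact h

/-- **Evenness**: `⟪U_{-s} ψ, ψ⟫ = ⟪U_s ψ, ψ⟫` (`U_{-s} = U_s⁻¹ = U_sᵀ` on the real Hilbert space `ℋ`). [folklore] -/
theorem inner_koopman_self_neg (s : ℝ) (ψ : D.FluctuationSpace) :
    ⟪D.koopman (-s) ψ, ψ⟫_ℝ = ⟪D.koopman s ψ, ψ⟫_ℝ := by
  have h := inner_koopman_koopman_eq D 0 s ψ
  rw [D.koopman_zero_apply, zero_sub] at h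
  rw [← h, real_inner_comm]

end Shape

/-- **Shape of the stress autocorrelation of any hard-sphere fluctuation data** (the registered helper): for every
`F : HardSphereFluctuationData σ` the function `c(s) = ⟪U_s ξ_Π, ξ_Π⟫_ℋ`, `ξ_Π = [cellObs (v ↦ v⁰v¹)]`, is
positive-definite, even, and bounded by `c(0) = ‖ξ_Π‖²` — so, IF continuous, it is the cosine transform of a finite
positive even measure (Bochner); stub C1 asserts that this measure has an integrable density. [folklore] -/
theorem stressAutocorrelation_shape :
    ∀ (σ : ℝ) (F : HardSphereFluctuationData σ),
      (∀ (n : ℕ) (s : Fin n → ℝ) (c : Fin n → ℝ),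
        0 ≤ ∑ i, ∑ j, c i * c j *
          ⟪F.koopman (s i - s j) (F.fluct (cellObs fun v : V3 => v 0 * v 1)),
            F.fluct (cellObs fun v : V3 => v 0 * v 1)⟫_ℝ) ∧
      (∀ s : ℝ, ⟪F.koopman (-s) (F.fluct (cellObs fun v : V3 => v 0 * v 1)),
          F.fluct (cellObs fun v : V3 => v 0 * v 1)⟫_ℝ =
        ⟪F.koopman s (F.fluct (cellObs fun v : V3 => v 0 * v 1)), F.fluct (cellObs fun v : V3 => v 0 * v 1)⟫_ℝ) ∧
      (∀ s : ℝ, |⟪F.koopman s (F.fluct (cellObs fun v : V3 => v 0 * v 1)),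
          F.fluct (cellObs fun v : V3 => v 0 * v 1)⟫_ℝ| ≤
        ⟪F.koopman 0 (F.fluct (cellObs fun v : V3 => v 0 * v 1)), F.fluct (cellObs fun v : V3 => v 0 * v 1)⟫_ℝ) := by
  intro σ F
  refine ⟨fun n s c => sum_mul_inner_koopman_nonneg F.toFluctuationDynamics Finset.univ s c _, fun s =>
    inner_koopman_self_neg F.toFluctuationDynamics s _, fun s => ?_⟩
  rw [inner_koopman_zero_self]
  exact abs_inner_koopman_self_le F.toFluctuationDynamics s _

end Summit.AtomisticToContinuum.HydrodynamicLimit.Theorems.MourreKoopmanChargesStressStrongMixing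

end
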